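import Mathlib.AlgebraicGeometry.Morphisms.UniversallyOpen
import Literature.AlgebraicGeometry.Motives.AbelianVarietyGoodReductionHom
import Literature.AlgebraicGeometry.Motives.AbelianVarietyKernelDimension
import HarnessLib

/-!
# The reduction of an isogeny is an isogeny

Layer `Literature/AlgebraicGeometry/Motives`, namespace
`Literature.AlgebraicGeometry.Motives.AbelianVariety.GoodReductionAt.HomReduction`.  KERNEL ONLY: theorems.  Cell
`hodgecm-mathlib` (D-0151), E2 line (A-p02's ASM skeleton, stub `stub_degree`; B-p05's DEG (a)
`kerRank_redHom_eq` takes the isogeny-ness of `λ̃` as its hypothesis `hred` — this file supplies it).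

For good-reduction data `R`, `S` of `A₀`, `B₀` at `v` and a reduction-of-homomorphisms datum `H`
(`liftHom f : 𝒜 → ℬ` the extension of `f : A₀ → B₀` to the models, `redHom f = f̃ : Ã → B̃` its special fibre):

* §1 `surjective_liftHom_left`: **if `f` is surjective then `Λ := liftHom f : 𝒜 → ℬ` is surjective.**  `Λ` is proper
  (`𝒜` proper over `𝓞_{K,v}`, `ℬ` separated; Mathlib `IsProper.of_comp`), so its image is closed; it contains the
  generic fibre `ℬ_K ≅ B₀` (`liftHom_left_comp`: the generic fibre of `Λ` is `f`, surjective); and every point of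
  `ℬ` generizes into the generic fibre because `ℬ → Spec 𝓞_{K,v}` is FLAT (smooth), hence generalizing
  (Mathlib `Flat.generalizingMap`) — a closed set containing a generization of `y` contains `y`.
* §2 `surjective_toSchemeHom_redHom`: hence `f̃` is surjective (it is the base change of `Λ` to `κ(v)`,
  `redHom_left_comp`, and surjectivity is stable under base change — private pasting lemma, the public one being
  `HodgeTheory.SpreadingOutQbar.isPullback_baseChangeHom_map_left` in a module too heavy to import here).
* §3 **`isIsogeny_redHom`: the reduction of an isogeny is an isogeny** (`f̃` surjective between abelian varieties of
  the same dimension `dim Ã = dim A₀ = dim B₀ = dim B̃`; `isIsogeny_of_surjective_of_dim_eq`) — Shimura §11.1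
  Prop. 12: «if `λ` is an isogeny, so is `λ̃`».

HC_CM is proved only modulo the printed citations until rung 0 closes; this file adds no hypothesis.

## References
* [Shimura1998] G. Shimura, *Abelian Varieties with Complex Multiplication and Modular Functions* (1998), §11.1
  Prop. 12 (p. 83) and its proof («`λ̃` is surjective [...] hence an isogeny if `A` and `B` have the same dimension»).
* [BombieriGubler2006] E. Bombieri, W. Gubler, *Heights in Diophantine Geometry*, 10.3.9 (Néron model, extension of
  morphisms).
-/

set_option autoImplicit false

noncomputable section

open CategoryTheory CategoryTheory.Limits AlgebraicGeometry IsDedekindDomain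
open IsDedekindDomain.HeightOneSpectrum (valuationSubringAtPrime)
open scoped NumberField

universe u

namespace Literature.AlgebraicGeometry.Motives

/-! ### §0 Base change of an `R`-morphism is a base change (any commutative base ring; private plumbing — the
public statement is `HodgeTheory.SpreadingOutQbar.isPullback_baseChangeHom_map_left`, whose module is too heavy
to import here) -/

/-- `X_σ = Y_σ ×_Y X` for an `R`-morphism `f : X ⟶ Y` over an arbitrary commutative base: the square with top
`π_X : X_σ ⟶ X`, left `f_σ`, right `f`, bottom `π_Y` is cartesian (pasting of the two defining pullbacks).
[cite: GortzWedhorn2020, Section (4.7)] -/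
private theorem isPullback_baseChangeHom_map_left_ring {k L : Type u} [CommRing k] [CommRing L] (σ : k →+* L)
    {X Y : SchemeOver k} (f : X ⟶ Y) :
    IsPullback (baseChangeHomFst σ X) ((baseChangeHom σ).map f).left f.left (baseChangeHomFst σ Y) := by
  have t : IsPullback (baseChangeHomFst σ Y) (pullback.snd Y.hom (Spec.map (CommRingCat.ofHom σ)))
      Y.hom (Spec.map (CommRingCat.ofHom σ)) :=
    IsPullback.of_hasPullback _ _
  have big : IsPullback (baseChangeHomFst σ X)
      (((baseChangeHom σ).map f).left ≫ pullback.snd Y.hom (Spec.map (CommRingCat.ofHom σ)))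
      (f.left ≫ Y.hom) (Spec.map (CommRingCat.ofHom σ)) := by
    have e₁ : ((baseChangeHom σ).map f).left ≫ pullback.snd Y.hom (Spec.map (CommRingCat.ofHom σ)) =
        pullback.snd X.hom (Spec.map (CommRingCat.ofHom σ)) :=
      pullback.lift_snd _ _ _
    rw [e₁, Over.w f]
    exact IsPullback.of_hasPullback _ _
  exact big.of_bot (baseChangeHom_map_left_comp_fst σ f).symm t

/-- Surjectivity is stable under the base change `f ↦ f_σ` of `R`-morphisms. [cite: GortzWedhorn2020, Prop. 4.32] -/
private theorem surjective_baseChangeHom_map_left {k L : Type u} [CommRing k] [CommRing L] (σ : k →+* L)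
    {X Y : SchemeOver k} (f : X ⟶ Y) [Surjective f.left] : Surjective ((baseChangeHom σ).map f).left :=
  MorphismProperty.of_isPullback (P := @Surjective) (isPullback_baseChangeHom_map_left_ring σ f) ‹_›

namespace AbelianVariety

namespace GoodReductionAt

namespace HomReduction

variable {K : Type} [Field K] [NumberField K] {A₀ B₀ : AbelianVariety K} {v : HeightOneSpectrum (𝓞 K)}
  {R : A₀.GoodReductionAt v} {S : B₀.GoodReductionAt v}

/-! ### §1 The extension of a surjective homomorphism to the models is surjective -/

/-- A point of an `𝓞_{K,v}`-scheme lying over the generic point `(0)` is in the image of the generic fibre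
`X ×_{𝓞_{K,v}} K → X` (Mathlib `Scheme.Pullback.range_fst`). [folklore] -/
private theorem mem_range_baseChangeHomFst_of_asIdeal_eq_bot (𝒳 : SchemeOver (valuationSubringAtPrime K v))
    (z : 𝒳.left) (hz : (𝒳.hom z).asIdeal = ⊥) :
    z ∈ Set.range (baseChangeHomFst (algebraMap (valuationSubringAtPrime K v) K) 𝒳) := by
  change z ∈ Set.range (pullback.fst 𝒳.hom (Spec.map (CommRingCat.ofHom (algebraMap _ K))))
  rw [Scheme.Pullback.range_fst]
  refine ⟨⟨⊥, Ideal.isPrime_bot⟩, ?_⟩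
  apply PrimeSpectrum.ext
  rw [hz, Spec.map_apply, PrimeSpectrum.comap_asIdeal, CommRingCat.hom_ofHom,
    Ideal.comap_bot_of_injective _ (IsFractionRing.injective (valuationSubringAtPrime K v) K)]

/-- The generic fibre `Λ_K` of the extension `Λ = liftHom f` is surjective when `f` is: through the two
`genericIso` it is `f` (`liftHom_left_comp`). [cite: BombieriGubler2006, 10.3.9 (p. 334)] -/
theorem surjective_baseChange_liftHom_left (H : HomReduction R S) (f : A₀ ⟶ B₀) [Surjective (Hom.toSchemeHom f)] :
    Surjective ((Literature.AlgebraicGeometry.Motives.baseChange (valuationSubringAtPrime K v) K).map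
      (H.liftHom f)).left := by
  have h := H.liftHom_left_comp f
  -- `Λ_K = gIso_R ≫ f ≫ gIso_S⁻¹`
  have e : ((Literature.AlgebraicGeometry.Motives.baseChange (valuationSubringAtPrime K v) K).map
      (H.liftHom f)).left =
        R.model.genericIso.hom.left ≫ Hom.toSchemeHom f ≫ S.model.genericIso.inv.left := by
    rw [← Category.assoc, ← h, Category.assoc, ← Over.comp_left, Iso.hom_inv_id, Over.id_left,
      Category.comp_id]
  rw [e]
  haveI : IsIso R.model.genericIso.hom.left := ((Over.forget _).mapIso R.model.genericIso).isIso_hom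
  haveI : IsIso S.model.genericIso.inv.left := ((Over.forget _).mapIso S.model.genericIso).isIso_inv
  infer_instance

/-- **`Λ = liftHom f : 𝒜 → ℬ` is surjective when `f` is** (`𝒜` proper, `ℬ` separated and flat over `𝓞_{K,v}`):
`Λ` has closed image containing the generic fibre, and every point of `ℬ` generizes into the generic fibre.
[cite: Shimura1998, §11.1 Prop. 12 (p. 83)] [cite: BombieriGubler2006, 10.3.9 (p. 334)] -/
theorem surjective_liftHom_left (H : HomReduction R S) (f : A₀ ⟶ B₀) [Surjective (Hom.toSchemeHom f)] :
    Surjective (H.liftHom f).left := by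
  haveI : IsProper R.model.total.hom := R.isSmoothProper.2
  haveI : IsProper S.model.total.hom := S.isSmoothProper.2
  haveI : SmoothOfRelativeDimension B₀.dim S.model.total.hom := S.isSmoothProper.1
  haveI : Smooth S.model.total.hom := SmoothOfRelativeDimension.smooth B₀.dim _
  -- `Λ` is proper, hence has closed image
  haveI : IsProper ((H.liftHom f).left ≫ S.model.total.hom) := by rw [Over.w (H.liftHom f)]; infer_instance
  haveI : IsProper (H.liftHom f).left := IsProper.of_comp (H.liftHom f).left S.model.total.hom
  have hclosed : IsClosed (Set.range (H.liftHom f).left) := (H.liftHom f).left.isClosedMap.isClosed_range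
  refine ⟨fun y => ?_⟩
  -- a generization `y'` of `y` in the generic fibre (`ℬ → Spec 𝓞` is flat, hence generalizing)
  have hgen : GeneralizingMap S.model.total.hom := Flat.generalizingMap S.model.total.hom
  have hsp : (⟨⊥, Ideal.isPrime_bot⟩ : PrimeSpectrum (valuationSubringAtPrime K v)) ⤳ S.model.total.hom y := by
    rw [← PrimeSpectrum.le_iff_specializes]
    exact fun _ h => by simp only [Submodule.mem_bot] at h; rw [h]; exact zero_mem _
  obtain ⟨y', hy'y, hy'⟩ := hgen hsp
  have hy'bot : (S.model.total.hom y').asIdeal = ⊥ := by rw [hy']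
  -- `y'` comes from the generic fibre, which is hit by `Λ_K`
  obtain ⟨z, hz⟩ := mem_range_baseChangeHomFst_of_asIdeal_eq_bot S.model.total y' hy'bot
  haveI := H.surjective_baseChange_liftHom_left f
  obtain ⟨a, ha⟩ := ((Literature.AlgebraicGeometry.Motives.baseChange (valuationSubringAtPrime K v) K).map
    (H.liftHom f)).left.surjective z
  have hnat : ∀ x, (H.liftHom f).left (baseChangeHomFst (algebraMap (valuationSubringAtPrime K v) K) R.model.total x) =
      baseChangeHomFst (algebraMap (valuationSubringAtPrime K v) K) S.model.total
        (((baseChangeHom (algebraMap (valuationSubringAtPrime K v) K)).map (H.liftHom f)).left x) := fun x => by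
    show (baseChangeHomFst _ R.model.total ≫ (H.liftHom f).left) x =
      (((baseChangeHom (algebraMap (valuationSubringAtPrime K v) K)).map (H.liftHom f)).left ≫
        baseChangeHomFst _ S.model.total) x
    rw [baseChangeHom_map_left_comp_fst]
  have hy'mem : y' ∈ Set.range (H.liftHom f).left := by
    refine ⟨baseChangeHomFst (algebraMap (valuationSubringAtPrime K v) K) R.model.total a, ?_⟩
    rw [hnat a]
    exact (congrArg (baseChangeHomFst (algebraMap (valuationSubringAtPrime K v) K) S.model.total) ha).trans hz
  -- the image is closed under specialization
  exact hy'y.mem_closed hclosed hy'mem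

/-! ### §2 The reduction of a surjective homomorphism is surjective -/

/-- **`f̃ = redHom f` is surjective when `f` is**: on underlying schemes `f̃` is the base change of
`Λ = liftHom f` to `κ(v)` (`redHom_left_comp`), `Λ` is surjective (§1), and surjectivity is stable under base
change. [cite: Shimura1998, §11.1 Prop. 12 (p. 83)] -/
theorem surjective_toSchemeHom_redHom (H : HomReduction R S) (f : A₀ ⟶ B₀) [Surjective (Hom.toSchemeHom f)] :
    Surjective (Hom.toSchemeHom (H.redHom f)) := by
  haveI := H.surjective_liftHom_left f
  haveI : Surjective (((baseChangeHom (residueAt v)).map (H.liftHom f)).left :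
      R.model.reductionAt.left ⟶ S.model.reductionAt.left) :=
    surjective_baseChangeHom_map_left (residueAt v) (H.liftHom f)
  haveI : IsIso R.reductionIso.hom.left := ((Over.forget _).mapIso R.reductionIso).isIso_hom
  haveI : IsIso S.reductionIso.hom.left := ((Over.forget _).mapIso S.reductionIso).isIso_hom
  have h1 : Function.Surjective R.reductionIso.hom.left := R.reductionIso.hom.left.homeomorph.surjective
  have h2 : Function.Surjective (((baseChangeHom (residueAt v)).map (H.liftHom f)).left :
      R.model.reductionAt.left ⟶ S.model.reductionAt.left) := Scheme.Hom.surjective _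
  have hcomp : Function.Surjective (Hom.toSchemeHom (H.redHom f) ≫ S.reductionIso.hom.left) := by
    rw [H.redHom_left_comp f]
    intro y
    obtain ⟨x', hx'⟩ := h2 y
    obtain ⟨x, hx⟩ := h1 x'
    refine ⟨x, ?_⟩
    change (((baseChangeHom (residueAt v)).map (H.liftHom f)).left :
      R.model.reductionAt.left ⟶ S.model.reductionAt.left) (R.reductionIso.hom.left x) = y
    rw [hx, hx']
  -- cancel the isomorphism `S.reductionIso.hom.left` on the right
  refine ⟨fun y => ?_⟩
  obtain ⟨x, hx⟩ := hcomp (S.reductionIso.hom.left y)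
  refine ⟨x, (S.reductionIso.hom.left.isOpenEmbedding.injective ?_)⟩
  rw [← Scheme.Hom.comp_apply]
  exact hx

/-! ### §3 The reduction of an isogeny is an isogeny -/

/-- **The reduction of an isogeny is an isogeny** (Shimura §11.1 Prop. 12): `f̃` is surjective (§2) between
abelian varieties of the same dimension, `dim Ã = dim A₀ = dim B₀ = dim B̃` (`dim_reduction`, `dim_eq_of_isIsogeny`),
hence an isogeny (`isIsogeny_of_surjective_of_dim_eq`). [cite: Shimura1998, §11.1 Prop. 12 (p. 83)] -/
theorem isIsogeny_redHom (H : HomReduction R S) {f : A₀ ⟶ B₀} (hf : IsIsogeny f) : IsIsogeny (H.redHom f) := by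
  haveI := hf.1
  haveI := H.surjective_toSchemeHom_redHom f
  exact isIsogeny_of_surjective_of_dim_eq (H.redHom f)
    (R.dim_reduction.trans ((dim_eq_of_isIsogeny hf).trans S.dim_reduction.symm))

end HomReduction

end GoodReductionAt

end AbelianVariety

end Literature.AlgebraicGeometry.Motives

end
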